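import Summits.CriticalPhenomena.PercolationContinuityZ3.Theorems.Transplant.TriFilmRouteT
import HarnessLib

/-!
# Routing in the triangular films — the sixteen EXCEPTIONAL configurations (blocked corners of the half-hexagon)

builds on p205010 (kernel theorem, internal audit signed; external expert review pending) — NOT used in this file.  Lane `prim-bschramm`, seat
`prim-bschramm-p2` (gen 33; class C1b; memo `HOME/bschramm/P2-LATTICES.md` §121); helper file (`--supports stmt-CriticalPhenomena-4575 --as helper`).

In the half-hexagon `{w₀ ≤ 0} ∩ hexBall 0 3` the corner `A = (0,3)` has exactly two block-neighbours, `B = (−1,3)` and `C = (0,2)`; when `{a₁, a₂} = {A, B}` and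
`a₃ = C` no planar leg reaches the corner off the other two targets («TriClawTable», `exceptional`), and likewise for the mirror images `(0,−3), (−1,−2), (0,−2)`.
These configurations are routed here directly in three dimensions (`k ≥ 2`), through the columns of `A, B, C, D' = (−1,2), E = (−2,3), F = (−2,2), G = (−1,1),
H = (0,1)` (resp. their mirror images under `(w₀,w₁) ↦ (w₀,−w₀−w₁)`), again as SWAP PAIRS:
* `a₁ = A, a₂ = B`: `L = column A (h₁ → λ) · (B,λ) · column B (λ → h₂)`, `Br = (C,λ) · column C (λ → h₃)`; swapped: `L' = column A · (C,λ) · (D',λ) · column D' ·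
  (B,h₂)`, `Br' = (B,λ) (E,λ) (F,λ) (G,λ) (H,λ) · column H · (C,h₃)`, with `λ ∉ {h₂, h₃}`;
* `a₁ = B, a₂ = A`: by cases on `h₁ = h₂` and `h₃`.
* **`TriFilm.exists_swap_pair_exceptional`**.
[cite: DuminilCopinSidoraviciusTassion2016, §2.3 (proof of Fact 2)]
-/

noncomputable section

namespace Summit.CriticalPhenomena.PercolationContinuityZ3.Theorems.Transplant

open Literature.Probability.Percolation Literature.Probability.LatticeModels SimpleGraph
open scoped Classical

namespace TriFilm

open TriClaw

variable {k : ℕ}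

/-- The adjacencies used by the exceptional routes. [folklore] -/
theorem X_adj (m : Bool) :
    triGraph.Adj (toSite (XA m)) (toSite (XB m)) ∧ triGraph.Adj (toSite (XA m)) (toSite (XC m)) ∧ triGraph.Adj (toSite (XB m)) (toSite (XC m)) ∧
    triGraph.Adj (toSite (XC m)) (toSite (XD m)) ∧ triGraph.Adj (toSite (XD m)) (toSite (XB m)) ∧ triGraph.Adj (toSite (XB m)) (toSite (XE m)) ∧
    triGraph.Adj (toSite (XE m)) (toSite (XF m)) ∧ triGraph.Adj (toSite (XF m)) (toSite (XG m)) ∧ triGraph.Adj (toSite (XG m)) (toSite (XH m)) ∧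
    triGraph.Adj (toSite (XH m)) (toSite (XC m)) := by
  cases m <;> exact ⟨adj_toSite (by decide), adj_toSite (by decide), adj_toSite (by decide), adj_toSite (by decide), adj_toSite (by decide),
    adj_toSite (by decide), adj_toSite (by decide), adj_toSite (by decide), adj_toSite (by decide), adj_toSite (by decide)⟩

/-- The eight columns are pairwise distinct. [folklore] -/
theorem X_nodup (m : Bool) : [XA m, XB m, XC m, XD m, XE m, XF m, XG m, XH m].Nodup := by cases m <;> decide

/-- All eight columns lie in the half-hexagon `{w₀ ≤ 0} ∩ hexBall 0 3`. [folklore] -/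
theorem X_mem (m : Bool) : ∀ p ∈ [XA m, XB m, XC m, XD m, XE m, XF m, XG m, XH m], tn p ≤ 3 ∧ p.1 ≤ 0 := by cases m <;> decide

/-- Distinctness of two of the eight columns, as `toSite` points. [folklore] -/
theorem X_ne {m : Bool} {p q : Pt} (_hp : p ∈ [XA m, XB m, XC m, XD m, XE m, XF m, XG m, XH m]) (_hq : q ∈ [XA m, XB m, XC m, XD m, XE m, XF m, XG m, XH m])
    (hpq : p ≠ q) : toSite p ≠ toSite q := fun h => hpq (toSite_injective h)

/-! ## Small film paths from explicit data -/

/-- A two-vertex path in a layer. [folklore] -/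
theorem fpath_two {p q : Pt} (hpq : triGraph.Adj (toSite p) (toSite q)) {j : ℕ} (hj : j ≤ k) :
    FPath k [vx k (toSite p) j, vx k (toSite q) j] (vx k (toSite p) j) (vx k (toSite q) j) := FPath.pair (adj_vx_planar hpq hj)

/-- A vertical two-vertex path. [folklore] -/
theorem fpath_step (q : Site 2) {j j' : ℕ} (hj : j ≤ k) (hj' : j' ≤ k) (h : j' = j + 1 ∨ j = j' + 1) : FPath k [vx k q j, vx k q j'] (vx k q j) (vx k q j') :=
  FPath.pair ((adj_vx_iff hj hj').2 (Or.inr ⟨rfl, h⟩))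

/-- A planar path of `toSite` points lifted to a layer, from the Boolean tests. [folklore] -/
theorem fpath_lay_pts {l : List Pt} (hne : l ≠ []) (hch : chainb l = true) (hnd : l.Nodup) {j : ℕ} (hj : j ≤ k) :
    FPath k (lay k j (l.map toSite)) (vx k (toSite (l.head hne)) j) (vx k (toSite (l.getLast hne)) j) := by
  have hne' : l.map toSite ≠ [] := by simpa using hne
  have := fpath_lay (k := k) hj hne' (by rw [List.isChain_map]; exact chainb_iff.1 hch) (hnd.map toSite_injective)
  rwa [List.head_map, List.getLast_map] at this

/-! ## The routes -/

section Routes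

variable (hk : 2 ≤ k) {RP D : Set (Site 2)} (hRP : ∀ w : Pt, tn w ≤ 3 → w.1 ≤ 0 → toSite w ∈ RP) (hD : ∀ w : Pt, tn w ≤ 3 → w.1 ≤ 0 → toSite w ∈ D)
include hk hRP hD

omit hk hD in
/-- Columns of the eight points are in `RP`. [folklore] -/
theorem X_RP (m : Bool) {p : Pt} (hp : p ∈ [XA m, XB m, XC m, XD m, XE m, XF m, XG m, XH m]) : toSite p ∈ RP :=
  hRP p (X_mem m p hp).1 (X_mem m p hp).2

omit hk hRP in
/-- Columns of the eight points are in `D`. [folklore] -/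
theorem X_D (m : Bool) {p : Pt} (hp : p ∈ [XA m, XB m, XC m, XD m, XE m, XF m, XG m, XH m]) : toSite p ∈ D :=
  hD p (X_mem m p hp).1 (X_mem m p hp).2

/-- **Type 1 (`a₁ = A`, `a₂ = B`, `a₃ = C`)**: the swap pair, all heights. [cite: DuminilCopinSidoraviciusTassion2016, §2.3 (proof of Fact 2)] -/
theorem exists_swap_pair_X1 (m : Bool) {h₁ h₂ h₃ : ℕ} (hh₁ : h₁ ≤ k) (hh₂ : h₂ ≤ k) (hh₃ : h₃ ≤ k)
    (hE : vx k (toSite (XA m)) h₁ ≠ vx k (toSite (XB m)) h₂) :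
    ∃ r₁ r₂ : (hexShadow k).RouteData RP D (vx k (toSite (XA m)) h₁) (vx k (toSite (XB m)) h₂) (vx k (toSite (XC m)) h₃), r₁.y = r₂.b ∧ r₁.b = r₂.y := by
  obtain ⟨hAB, hAC, hBC, hCD, hDB, hBE, hEF, hFG, hGH, hHC⟩ := X_adj m
  have hnd := X_nodup m
  have hmemA : XA m ∈ [XA m, XB m, XC m, XD m, XE m, XF m, XG m, XH m] := by simp
  have hmemB : XB m ∈ [XA m, XB m, XC m, XD m, XE m, XF m, XG m, XH m] := by simp
  have hmemC : XC m ∈ [XA m, XB m, XC m, XD m, XE m, XF m, XG m, XH m] := by simp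
  have hmemD : XD m ∈ [XA m, XB m, XC m, XD m, XE m, XF m, XG m, XH m] := by simp
  have hmemH : XH m ∈ [XA m, XB m, XC m, XD m, XE m, XF m, XG m, XH m] := by simp
  -- distinct columns
  have dAB : toSite (XA m) ≠ toSite (XB m) := fun h => by have := toSite_injective h; revert this; cases m <;> decide
  have dAC : toSite (XA m) ≠ toSite (XC m) := fun h => by have := toSite_injective h; revert this; cases m <;> decide
  have dAD : toSite (XA m) ≠ toSite (XD m) := fun h => by have := toSite_injective h; revert this; cases m <;> decide
  have dBC : toSite (XB m) ≠ toSite (XC m) := fun h => by have := toSite_injective h; revert this; cases m <;> decide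
  have dBD : toSite (XB m) ≠ toSite (XD m) := fun h => by have := toSite_injective h; revert this; cases m <;> decide
  have dCD : toSite (XC m) ≠ toSite (XD m) := fun h => by have := toSite_injective h; revert this; cases m <;> decide
  have dAH : toSite (XA m) ≠ toSite (XH m) := fun h => by have := toSite_injective h; revert this; cases m <;> decide
  have dCH : toSite (XC m) ≠ toSite (XH m) := fun h => by have := toSite_injective h; revert this; cases m <;> decide
  have dDH : toSite (XD m) ≠ toSite (XH m) := fun h => by have := toSite_injective h; revert this; cases m <;> decide
  -- the auxiliary layer
  set lam := fresh h₂ h₃ with hlam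
  obtain ⟨hl2, hl3, hl⟩ := fresh_spec h₂ h₃
  rw [← hlam] at hl2 hl3 hl
  have hlk : lam ≤ k := hl.trans hk
  -- Route 1
  have P1 : FPath k (vseg k (toSite (XA m)) h₁ lam) (vx k (toSite (XA m)) h₁) (vx k (toSite (XA m)) lam) := fpath_vseg (toSite (XA m)) hh₁ hlk
  have P2 : FPath k [vx k (toSite (XA m)) lam, vx k (toSite (XB m)) lam] (vx k (toSite (XA m)) lam) (vx k (toSite (XB m)) lam) := FPath.pair (adj_vx_planar hAB hlk)
  have P3 : FPath k (vseg k (toSite (XB m)) lam h₂) (vx k (toSite (XB m)) lam) (vx k (toSite (XB m)) h₂) := fpath_vseg (toSite (XB m)) hlk hh₂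
  have S₁ : FPath k (vseg k (toSite (XA m)) h₁ lam ++ [vx k (toSite (XA m)) lam, vx k (toSite (XB m)) lam].tail) (vx k (toSite (XA m)) h₁) (vx k (toSite (XB m)) lam) := by
    refine P1.trans P2 fun v hv hv1 => ?_
    simp only [List.mem_cons, List.not_mem_nil, or_false] at hv
    rcases hv with rfl | rfl
    · rfl
    · exact absurd (fst_of_mem_vseg hv1) dAB.symm
  have SL : FPath k ((vseg k (toSite (XA m)) h₁ lam ++ [vx k (toSite (XA m)) lam, vx k (toSite (XB m)) lam].tail) ++ (vseg k (toSite (XB m)) lam h₂).tail) (vx k (toSite (XA m)) h₁) (vx k (toSite (XB m)) h₂) := by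
    refine S₁.trans P3 fun v hv hv1 => ?_
    obtain ⟨i, hi1, hi2, rfl⟩ := mem_vseg.1 hv
    have hik : i ≤ k := le_trans hi2 (max_le hlk hh₂)
    rcases List.mem_append.1 hv1 with h | h
    · exact absurd (fst_of_mem_vseg h) dAB.symm
    · simp only [List.tail_cons, List.mem_singleton] at h
      exact h
  set L := (vseg k (toSite (XA m)) h₁ lam ++ [vx k (toSite (XA m)) lam, vx k (toSite (XB m)) lam].tail) ++ (vseg k (toSite (XB m)) lam h₂).tail with hL
  have mL : ∀ v ∈ L, v ∈ vseg k (toSite (XA m)) h₁ lam ∨ v ∈ vseg k (toSite (XB m)) lam h₂ := by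
    intro v hv
    rcases List.mem_append.1 hv with hv | hv
    · rcases List.mem_append.1 hv with hv | hv
      · exact Or.inl hv
      · right; simp only [List.tail_cons, List.mem_singleton] at hv; rw [hv]; exact (fpath_vseg (toSite (XB m)) hlk hh₂).head_mem
    · exact Or.inr (List.mem_of_mem_tail hv)
  have hLRP : ∀ v ∈ L, ((v : triFilm k) : Site 2 × Site 1).1 ∈ RP := by
    intro v hv
    rcases mL v hv with h | h
    · rw [fst_of_mem_vseg h]; exact X_RP hRP m hmemA
    · rw [fst_of_mem_vseg h]; exact X_RP hRP m hmemB
  have Q1 : FPath k [vx k (toSite (XA m)) lam, vx k (toSite (XC m)) lam] (vx k (toSite (XA m)) lam) (vx k (toSite (XC m)) lam) := FPath.pair (adj_vx_planar hAC hlk)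
  have Q2 : FPath k (vseg k (toSite (XC m)) lam h₃) (vx k (toSite (XC m)) lam) (vx k (toSite (XC m)) h₃) := fpath_vseg (toSite (XC m)) hlk hh₃
  have RC : FPath k ([vx k (toSite (XA m)) lam, vx k (toSite (XC m)) lam] ++ (vseg k (toSite (XC m)) lam h₃).tail) (vx k (toSite (XA m)) lam) (vx k (toSite (XC m)) h₃) := by
    refine Q1.trans Q2 fun v hv hv1 => ?_
    simp only [List.mem_cons, List.not_mem_nil, or_false] at hv1
    rcases hv1 with rfl | rfl
    · exact absurd (fst_of_mem_vseg hv) dAC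
    · rfl
  set CB := [vx k (toSite (XA m)) lam, vx k (toSite (XC m)) lam] ++ (vseg k (toSite (XC m)) lam h₃).tail with hCB
  have mCBt : ∀ v ∈ CB.tail, v ∈ vseg k (toSite (XC m)) lam h₃ := by
    intro v hv
    simp only [hCB, List.cons_append, List.tail_cons, List.mem_cons] at hv
    rcases hv with rfl | hv
    · exact Q2.head_mem
    · exact List.mem_of_mem_tail hv
  have hsplit : L = (vseg k (toSite (XA m)) h₁ lam).dropLast ++ vx k (toSite (XA m)) lam :: vx k (toSite (XB m)) lam :: (vseg k (toSite (XB m)) lam h₂).tail := by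
    rw [hL]
    conv_lhs => rw [← List.dropLast_append_getLast P1.ne_nil]
    have : (vseg k (toSite (XA m)) h₁ lam).getLast P1.ne_nil = vx k (toSite (XA m)) lam := by
      have := P1.last; rw [List.getLast?_eq_some_getLast P1.ne_nil, Option.some.injEq] at this; exact this
    rw [this]; simp
  have r₁ : ∃ r : (hexShadow k).RouteData RP D (vx k (toSite (XA m)) h₁) (vx k (toSite (XB m)) h₂) (vx k (toSite (XC m)) h₃), r.y = vx k (toSite (XB m)) lam ∧ r.b = vx k (toSite (XC m)) lam := by
    refine ⟨routeData_of_paths SL hE hLRP hsplit RC (by simp [hCB]) (fun v hv => ?_) (fun v hv hvL => ?_), rfl,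
      routeData_of_paths_b SL hE hLRP hsplit RC _ _ _ (rest := (vseg k (toSite (XC m)) lam h₃).tail) (by simp [hCB])⟩
    · rw [fst_of_mem_vseg (mCBt v hv)]; exact X_D hD m hmemC
    · have hc := fst_of_mem_vseg (mCBt v hv)
      rcases mL v hvL with h | h
      · exact dAC ((fst_of_mem_vseg h).symm.trans hc)
      · exact dBC ((fst_of_mem_vseg h).symm.trans hc)
  -- Route 2
  have P2' : FPath k [vx k (toSite (XA m)) lam, vx k (toSite (XC m)) lam, vx k (toSite (XD m)) lam] (vx k (toSite (XA m)) lam) (vx k (toSite (XD m)) lam) := by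
    refine ⟨by simp, List.isChain_cons_cons.2 ⟨adj_vx_planar hAC hlk, List.isChain_cons_cons.2 ⟨adj_vx_planar hCD hlk, List.IsChain.singleton _⟩⟩,
      ?_, rfl, rfl⟩
    have d1 : vx k (toSite (XA m)) lam ≠ vx k (toSite (XC m)) lam := fun h => dAC ((vx_inj hlk hlk).1 h).1
    have d2 : vx k (toSite (XA m)) lam ≠ vx k (toSite (XD m)) lam := fun h => dAD ((vx_inj hlk hlk).1 h).1
    have d3 : vx k (toSite (XC m)) lam ≠ vx k (toSite (XD m)) lam := fun h => dCD ((vx_inj hlk hlk).1 h).1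
    simp [d1, d2, d3]
  have P3' : FPath k (vseg k (toSite (XD m)) lam h₂) (vx k (toSite (XD m)) lam) (vx k (toSite (XD m)) h₂) := fpath_vseg (toSite (XD m)) hlk hh₂
  have P4' : FPath k [vx k (toSite (XD m)) h₂, vx k (toSite (XB m)) h₂] (vx k (toSite (XD m)) h₂) (vx k (toSite (XB m)) h₂) := FPath.pair (adj_vx_planar hDB hh₂)
  have S₁' : FPath k (vseg k (toSite (XA m)) h₁ lam ++ [vx k (toSite (XA m)) lam, vx k (toSite (XC m)) lam, vx k (toSite (XD m)) lam].tail) (vx k (toSite (XA m)) h₁) (vx k (toSite (XD m)) lam) := by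
    refine P1.trans P2' fun v hv hv1 => ?_
    simp only [List.mem_cons, List.not_mem_nil, or_false] at hv
    rcases hv with rfl | rfl | rfl
    · rfl
    · exact absurd (fst_of_mem_vseg hv1) dAC.symm
    · exact absurd (fst_of_mem_vseg hv1) dAD.symm
  have S₂' : FPath k ((vseg k (toSite (XA m)) h₁ lam ++ [vx k (toSite (XA m)) lam, vx k (toSite (XC m)) lam, vx k (toSite (XD m)) lam].tail) ++ (vseg k (toSite (XD m)) lam h₂).tail) (vx k (toSite (XA m)) h₁) (vx k (toSite (XD m)) h₂) := by
    refine S₁'.trans P3' fun v hv hv1 => ?_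
    obtain ⟨i, hi1, hi2, rfl⟩ := mem_vseg.1 hv
    have hik : i ≤ k := le_trans hi2 (max_le hlk hh₂)
    rcases List.mem_append.1 hv1 with h | h
    · exact absurd (fst_of_mem_vseg h) dAD.symm
    · simp only [List.tail_cons, List.mem_cons, List.not_mem_nil, or_false] at h
      rcases h with h | h
      · exact absurd ((vx_inj hik hlk).1 h).1 dCD.symm
      · exact h
  set T' := (vseg k (toSite (XA m)) h₁ lam ++ [vx k (toSite (XA m)) lam, vx k (toSite (XC m)) lam, vx k (toSite (XD m)) lam].tail) ++ (vseg k (toSite (XD m)) lam h₂).tail with hT'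
  have mT' : ∀ v ∈ T', v ∈ vseg k (toSite (XA m)) h₁ lam ∨ v = vx k (toSite (XC m)) lam ∨ v ∈ vseg k (toSite (XD m)) lam h₂ := by
    intro v hv
    rcases List.mem_append.1 hv with hv | hv
    · rcases List.mem_append.1 hv with hv | hv
      · exact Or.inl hv
      · simp only [List.tail_cons, List.mem_cons, List.not_mem_nil, or_false] at hv
        rcases hv with rfl | rfl
        · exact Or.inr (Or.inl rfl)
        · exact Or.inr (Or.inr P3'.head_mem)
    · exact Or.inr (Or.inr (List.mem_of_mem_tail hv))
  have SL' : FPath k (T' ++ [vx k (toSite (XD m)) h₂, vx k (toSite (XB m)) h₂].tail) (vx k (toSite (XA m)) h₁) (vx k (toSite (XB m)) h₂) := by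
    refine S₂'.trans P4' fun v hv hv1 => ?_
    simp only [List.mem_cons, List.not_mem_nil, or_false] at hv
    rcases hv with rfl | rfl
    · rfl
    · exfalso
      rcases mT' _ hv1 with h | h | h
      · exact dAB (fst_of_mem_vseg h).symm
      · exact dBC ((vx_inj hh₂ hlk).1 h).1
      · exact dBD (fst_of_mem_vseg h)
  set L' := T' ++ [vx k (toSite (XD m)) h₂, vx k (toSite (XB m)) h₂].tail with hL'
  have mL' : ∀ v ∈ L', v ∈ vseg k (toSite (XA m)) h₁ lam ∨ v = vx k (toSite (XC m)) lam ∨ v ∈ vseg k (toSite (XD m)) lam h₂ ∨ v = vx k (toSite (XB m)) h₂ := by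
    intro v hv
    rcases List.mem_append.1 hv with hv | hv
    · rcases mT' v hv with h | h | h
      · exact Or.inl h
      · exact Or.inr (Or.inl h)
      · exact Or.inr (Or.inr (Or.inl h))
    · simp only [List.tail_cons, List.mem_singleton] at hv; exact Or.inr (Or.inr (Or.inr hv))
  have hLRP' : ∀ v ∈ L', ((v : triFilm k) : Site 2 × Site 1).1 ∈ RP := by
    intro v hv
    rcases mL' v hv with h | h | h | h
    · rw [fst_of_mem_vseg h]; exact X_RP hRP m hmemA
    · rw [h]; exact X_RP hRP m hmemC
    · rw [fst_of_mem_vseg h]; exact X_RP hRP m hmemD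
    · rw [h]; exact X_RP hRP m hmemB
  -- the branch of Route 2: `(toSite (XA m)) · (toSite (XB m)) (toSite (XE m)) (toSite (XF m)) (toSite (XG m)) (toSite (XH m)) (layer lam) · column (toSite (XH m)) · (toSite (XC m))`
  have Q1' : FPath k (lay k lam ([XA m, XB m, XE m, XF m, XG m, XH m].map toSite)) (vx k (toSite (XA m)) lam) (vx k (toSite (XH m)) lam) :=
    fpath_lay_pts (by simp) (by cases m <;> decide) (by cases m <;> decide) hlk
  have Q2' : FPath k (vseg k (toSite (XH m)) lam h₃) (vx k (toSite (XH m)) lam) (vx k (toSite (XH m)) h₃) := fpath_vseg (toSite (XH m)) hlk hh₃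
  have Q3' : FPath k [vx k (toSite (XH m)) h₃, vx k (toSite (XC m)) h₃] (vx k (toSite (XH m)) h₃) (vx k (toSite (XC m)) h₃) := FPath.pair (adj_vx_planar hHC hh₃)
  have mQ1' : ∀ v ∈ lay k lam ([XA m, XB m, XE m, XF m, XG m, XH m].map toSite), ∃ p ∈ [XA m, XB m, XE m, XF m, XG m, XH m], v = vx k (toSite p) lam := by
    intro v hv
    obtain ⟨q, hq, rfl⟩ := mem_lay.1 hv
    obtain ⟨p, hp, rfl⟩ := List.mem_map.1 hq
    exact ⟨p, hp, rfl⟩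
  have R₁' : FPath k (lay k lam ([XA m, XB m, XE m, XF m, XG m, XH m].map toSite) ++ (vseg k (toSite (XH m)) lam h₃).tail) (vx k (toSite (XA m)) lam) (vx k (toSite (XH m)) h₃) := by
    refine Q1'.trans Q2' fun v hv hv1 => ?_
    obtain ⟨i, hi1, hi2, rfl⟩ := mem_vseg.1 hv
    have hik : i ≤ k := le_trans hi2 (max_le hlk hh₃)
    obtain ⟨p, hp, he⟩ := mQ1' _ hv1
    obtain ⟨-, rfl⟩ := (vx_inj hik hlk).1 he
    rfl
  have RC' : FPath k ((lay k lam ([XA m, XB m, XE m, XF m, XG m, XH m].map toSite) ++ (vseg k (toSite (XH m)) lam h₃).tail) ++ [vx k (toSite (XH m)) h₃, vx k (toSite (XC m)) h₃].tail)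
      (vx k (toSite (XA m)) lam) (vx k (toSite (XC m)) h₃) := by
    refine R₁'.trans Q3' fun v hv hv1 => ?_
    simp only [List.mem_cons, List.not_mem_nil, or_false] at hv
    rcases hv with rfl | rfl
    · rfl
    · exfalso
      rcases List.mem_append.1 hv1 with h | h
      · obtain ⟨p, hp, he⟩ := mQ1' _ h
        have := ((vx_inj hh₃ hlk).1 he).2
        exact hl3 this.symm
      · exact dCH (fst_of_mem_vseg (List.mem_of_mem_tail h))
  set CB' := (lay k lam ([XA m, XB m, XE m, XF m, XG m, XH m].map toSite) ++ (vseg k (toSite (XH m)) lam h₃).tail) ++ [vx k (toSite (XH m)) h₃, vx k (toSite (XC m)) h₃].tail with hCB'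
  have mCB' : ∀ v ∈ CB', (∃ p ∈ [XA m, XB m, XE m, XF m, XG m, XH m], v = vx k (toSite p) lam) ∨ v ∈ vseg k (toSite (XH m)) lam h₃ ∨ v = vx k (toSite (XC m)) h₃ := by
    intro v hv
    rcases List.mem_append.1 hv with hv | hv
    · rcases List.mem_append.1 hv with hv | hv
      · exact Or.inl (mQ1' v hv)
      · exact Or.inr (Or.inl (List.mem_of_mem_tail hv))
    · simp only [List.tail_cons, List.mem_singleton] at hv; exact Or.inr (Or.inr hv)
  have hCBeq' : CB' = vx k (toSite (XA m)) lam :: vx k (toSite (XB m)) lam :: (lay k lam ([XE m, XF m, XG m, XH m].map toSite) ++ (vseg k (toSite (XH m)) lam h₃).tail ++ [vx k (toSite (XC m)) h₃]) := by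
    rw [hCB']; simp [lay]
  have hsplit' : L' = (vseg k (toSite (XA m)) h₁ lam).dropLast ++ vx k (toSite (XA m)) lam :: vx k (toSite (XC m)) lam :: (vx k (toSite (XD m)) lam :: ((vseg k (toSite (XD m)) lam h₂).tail ++ [vx k (toSite (XB m)) h₂])) := by
    rw [hL', hT']
    conv_lhs => rw [← List.dropLast_append_getLast P1.ne_nil]
    have : (vseg k (toSite (XA m)) h₁ lam).getLast P1.ne_nil = vx k (toSite (XA m)) lam := by
      have := P1.last; rw [List.getLast?_eq_some_getLast P1.ne_nil, Option.some.injEq] at this; exact this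
    rw [this]; simp
  have r₂ : ∃ r : (hexShadow k).RouteData RP D (vx k (toSite (XA m)) h₁) (vx k (toSite (XB m)) h₂) (vx k (toSite (XC m)) h₃), r.y = vx k (toSite (XC m)) lam ∧ r.b = vx k (toSite (XB m)) lam := by
    have hCBne : CB'.tail ≠ [] := by rw [hCBeq']; simp
    have hCBD : ∀ v ∈ CB'.tail, ((v : triFilm k) : Site 2 × Site 1).1 ∈ D := by
      intro v hv
      rcases mCB' v (List.mem_of_mem_tail hv) with ⟨p, hp, rfl⟩ | h | h
      · have hp8 : p ∈ [XA m, XB m, XC m, XD m, XE m, XF m, XG m, XH m] := by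
          simp only [List.mem_cons, List.not_mem_nil, or_false] at hp ⊢
          rcases hp with h | h | h | h | h | h <;> simp [h]
        exact X_D hD m hp8
      · rw [fst_of_mem_vseg h]; exact X_D hD m hmemH
      · rw [h]; exact X_D hD m hmemC
    have hdisj : ∀ v ∈ CB'.tail, v ∉ L' := by
      intro v hv hvL
      have hvA : v ≠ vx k (toSite (XA m)) lam := fun e => RC'.not_mem_tail (e ▸ hv)
      rcases mCB' v (List.mem_of_mem_tail hv) with ⟨p, hp, rfl⟩ | h | h
      · -- a layer-`lam` vertex over `(toSite (XA m)), (toSite (XB m)), (toSite (XE m)), (toSite (XF m)), (toSite (XG m)), (toSite (XH m))`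
        rcases mL' _ hvL with h' | h' | h' | h'
        · have hc := fst_of_mem_vseg h'; simp only [vx_fst] at hc
          have hpA : p = XA m := toSite_injective hc
          subst hpA; exact hvA rfl
        · have := ((vx_inj hlk hlk).1 h').1
          have hpC : p = XC m := toSite_injective this
          rw [hpC] at hp; revert hp; cases m <;> decide
        · have hc := fst_of_mem_vseg h'; simp only [vx_fst] at hc
          have hpD : p = XD m := toSite_injective hc
          rw [hpD] at hp; revert hp; cases m <;> decide
        · exact hl2 ((vx_inj hlk hh₂).1 h').2
      · -- a vertex of the column `(toSite (XH m))`
        have hc := fst_of_mem_vseg h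
        rcases mL' _ hvL with h' | h' | h' | h'
        · exact dAH ((fst_of_mem_vseg h').symm.trans hc)
        · rw [h'] at hc; exact dCH hc
        · exact dDH ((fst_of_mem_vseg h').symm.trans hc)
        · rw [h'] at hc; exact (X_ne hmemB hmemH (by cases m <;> decide)) hc
      · -- `((toSite (XC m)), h₃)`
        subst h
        rcases mL' _ hvL with h' | h' | h' | h'
        · exact dAC (fst_of_mem_vseg h').symm
        · exact hl3 ((vx_inj hh₃ hlk).1 h').2.symm
        · exact dCD (fst_of_mem_vseg h')
        · exact dBC ((vx_inj hh₃ hh₂).1 h').1.symm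
    refine ⟨routeData_of_paths SL' hE hLRP' hsplit' RC' hCBne hCBD hdisj, rfl, routeData_of_paths_b SL' hE hLRP' hsplit' RC' hCBne hCBD hdisj hCBeq'⟩
  obtain ⟨r₁, hy₁, hb₁⟩ := r₁
  obtain ⟨r₂, hy₂, hb₂⟩ := r₂
  exact ⟨r₁, r₂, by rw [hy₁, hb₂], by rw [hb₁, hy₂]⟩

end Routes

end TriFilm

end Summit.CriticalPhenomena.PercolationContinuityZ3.Theorems.Transplant

end
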